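import Summits.CriticalPhenomena.PercolationContinuityZ3.Theorems.Transplant.SkelSign2ParamsAtQ2
import Summits.CriticalPhenomena.PercolationContinuityZ3.Theorems.Transplant.SkelSign2ParamsCounts
import Summits.CriticalPhenomena.PercolationContinuityZ3.Theorems.Transplant.SkelSign2ParamsDepth
import Summits.CriticalPhenomena.PercolationContinuityZ3.Theorems.Transplant.SkelSign2ParamsWidths
import HarnessLib

/-!
# D″ L7′ params, part 9: THE ROOT-RUN VALUES of `signChoice₂` and their rooms ((R), p2-g8's `Skelφ.rootOblT_concSG_raw` binder list, SIGN-PARAMS.md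
# §9 / (A5); DPRIME-SCOPE N.6: the root run takes the SHORT stride throughout) — per run axis `a` (`∥ := a`, `⊥ := oth a`, `du.1 = a`): start row
# `q := 0`, transverse offset `cb := 0`, stride `s₁ := e∥`, first-hop extent `ℓ1∥`, landing row `caR := 5 r∥ + 1 + e∥ + 2R′`, landing half-width
# `qR' := widths a ℓ1∥ ⊥`, far-line count `NR := (17 r∥ − caR)/e∥`, band widths `WbR ℓ := widths a (max ℓ ℓ₀∥) ⊥`, `WMR := widths a (e∥ + R′) ⊥`, the
# TRANSVERSE region half-width `ρR := qR' + (NR+1)R′ + 2·WMR` (F-DP4-2: transverse only; the backward extent is `ρ₀R := e∥ + 2R′`), the first-hop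
# window depths `R₀ := 5 r∥ + ψ(D.k) + off`, `Rp := 5 r∥ + ψ(amax (widths a ℓ1∥))`, and the root tube radius `Rt := F 1 − L′ − 1` at `q`;
# with: the `BandROK` fields (`hq hq' hs hs2 hρ hWM`), the placement rooms of `RootRun2.RootBandOK` (`hlo hhi htr hloM hhiM htrM`, `cb = 0`),
# `NR ≤ 12A ≤ nmax A` (so `δkit ≤ δr NR`: `hδI`, `hk`, `hcount`, `hη` at accuracy `δr NR`), and the depth orderings against `L′`, `E₀`, `Rt`
# (twin of SkelConcParamsRoot, p238642).  The width values `qR' WbR WMR` and the facts `root_std_at`, `root_route_at` live in `SkelSign2ParamsWidths`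
# (imported; lead ruling 2026-08-21T08:21:49Z) — same names, same arguments.

builds on p205010 (kernel theorem, internal audit signed; external expert review pending) — nothing in this file uses p205010.
Status sentence (coordinator 2026-08-20T04:30Z): "θ(p_c) = 0 on ℤ^d, all d ≥ 2 — kernel-verified (Lean 4/Mathlib, standard axioms); internal adversarial
audit SIGNED 2026-08-20 04:29Z; external expert review pending."
Lane `prim-bschramm-*`, seat `prim-bschramm-stmt` (gen 9); helper file (`--supports stmt-CriticalPhenomena-4575`).  The radius identities of the schedule
at the root (`Rt + 1 ≤ rB 0 0 du / rQ 0 (0+du) / rM 0 (0+du)`, `rQ 0 0 ≤ E₀`) are p2's `root_radii_concRadii2S` (SkelPhiRootRadii); here only `E₀`/`F 1`-level facts.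
[cite: KozmaNitzan2024, §4 Theorem 6 (pp. 27–28: the root cube (32)), Lemma 11 (pp. 22–23)]
-/

noncomputable section

open MeasureTheory
open scoped Classical

namespace Summit.CriticalPhenomena.PercolationContinuityZ3.Theorems.Transplant

namespace PlanarSkeletonSign

namespace Sgn₂

open Literature.Probability.Percolation Literature.Probability.LatticeModels SimpleGraph
open Literature.Probability.Percolation.KozmaNitzan.Cells (oth)
open SkelConc (Consts)
open Sgn (K a A L twenty_le_K one_le_a hundred_le_A K_le_A five_le_L sixteen_L_le_A δkit δI m₀ Mu ρz M T₀ Kd Rseed rs cU sB B kP NP Lcnt Rlev R' η reachK Sz L_hyps)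
open BoxProdZ2 (ConcRadiiG Erad Frad)

section Defs

variable (κ : Consts) {V : Type} [DecidableEq V] [Countable V] {G : SimpleGraph V} [G.LocallyFinite] (Φ : PlanarSkeletonSign G)
  (p : unitInterval) (O : Skelφ.StepI.Out V) (a : Fin 2)

/-- **The landing row of the first hop** `caR := 5 r∥ + 1 + e∥ + 2R′` (region 0 of the run, `ρ₀ = e∥ + 2R′` below it, clears the wired root cube). [this work] -/
def caR : ℕ := 5 * (cells κ Φ p O).r a + 1 + e κ Φ p O a + 2 * R' κ Φ p O

/-- **The far-line count** `NR := (17 r∥ − caR)/e∥` (`17 r∥ ≤ caR + (NR+1)e∥ ≤ 23 r∥`). [this work] -/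
def NR : ℕ := (17 * (cells κ Φ p O).r a - caR κ Φ p O a) / e κ Φ p O a

/-- **The TRANSVERSE region half-width** `ρR := qR' + (NR+1)R′ + 2·WMR` (= `BandROK.hρ` with equality; F-DP4-2). [this work] -/
def ρR : ℕ := qR' κ Φ p O a + (NR κ Φ p O a + 1) * R' κ Φ p O + 2 * WMR κ Φ p O a

/-- The backward extent of region 0: `ρ₀R := 3·0 + s₁ + 2R′ = e∥ + 2R′`. [this work] -/
def ρ₀R : ℕ := e κ Φ p O a + 2 * R' κ Φ p O

/-- The first-hop seed window depth `R₀ := 5 r∥ + ψ(D.k) + off`. [this work] -/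
def R₀R : ℕ := 5 * (cells κ Φ p O).r a + O.D.R O.D.k + O.off

/-- The first-hop prism window depth `Rp := 5 r∥ + ψ(amax (widths a ℓ1∥))`. [this work] -/
def RpR : ℕ := 5 * (cells κ Φ p O).r a + O.D.R (Skelφ.amax (Skelφ.StepI.widths O.D.Gb O.D.Fb a (ℓ1 κ Φ p O a)))

/-- The first-hop seed window depth, uniform over the directions: `R₀U := 5 rmax + ψ(D.k) + off`. [this work] -/
def R₀U : ℕ := 5 * (cells κ Φ p O).rmax + O.D.R O.D.k + O.off

/-- The first-hop prism window depth, uniform over the directions: `RpU := 5 rmax + ψ(topScale)` (`≥ 5 rmax + ψ(amax (widths a ℓ1∥))`). [this work] -/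
def RpU : ℕ := 5 * (cells κ Φ p O).rmax + O.D.R (topScale κ Φ p O)

/-- **The root tube radius at `q`**: `Rt := F 1 − L′ − 1` (so `Rt + 1 = F 1 − L′ = rM 0 (0+du)`). [this work] -/
def Rt (q : unitInterval) : ℕ :=
  Frad (Skelφ.Prm.gap (schedIn κ Φ p O q)) (fun _ => 0) (Skelφ.Prm.E₀ (schedIn κ Φ p O q)) 1 - Skelφ.Prm.Lp (schedIn κ Φ p O q) - 1

end Defs

/-- The larger half-width of a band rectangle is at most `max ℓ (max (Gb ℓ) (Fb ℓ))`. [folklore] -/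
theorem amax_widths_le (Gb Fb : ℕ → ℕ) (a : Fin 2) (ℓ : ℕ) :
    Skelφ.amax (Skelφ.StepI.widths Gb Fb a ℓ) ≤ max ℓ (max (Gb ℓ) (Fb ℓ)) := by
  unfold Skelφ.amax
  refine max_le ?_ ?_ <;> fin_cases a <;> simp [Skelφ.StepI.widths]

section AtQ

variable {κ : Consts} {V : Type} [DecidableEq V] [Countable V] {G : SimpleGraph V} [G.LocallyFinite] {Φ : PlanarSkeletonSign G}
  {t : V} {p : unitInterval} {hC : Φ.CylSubcritical p} {O : Skelφ.StepI.Out V} {q : unitInterval}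
  (hat : (choiceAt κ Φ t p hC).AtQ O q)
include hat

/-! ## §1 The band fields (`BandROK`: `hq hq' hs hs2 hρ hWM`, with `q := 0`, `s₁ := e∥`, `ℓ₀ := ℓ₀∥`) -/

/-- **`BandROK` fields of the root run**: `0 ≤ 0`, `0 ≤ qR'`, `R′ + ℓ₀∥ ≤ e∥`, `2R′ ≤ e∥`, `qR' + (NR+1)R′ + 2WMR ≤ ρR` (equality),
`∀ ℓ ≤ 2·0 + e∥ + R′, WbR ℓ ≤ WMR`. [folklore] -/
theorem root_band_fields (a : Fin 2) : R' κ Φ p O + ℓ₀ κ Φ p O a ≤ e κ Φ p O a ∧ 2 * R' κ Φ p O ≤ e κ Φ p O a ∧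
    qR' κ Φ p O a + (NR κ Φ p O a + 1) * R' κ Φ p O + 2 * WMR κ Φ p O a ≤ ρR κ Φ p O a ∧
    ∀ ℓ, ℓ ≤ 2 * 0 + e κ Φ p O a + R' κ Φ p O → WbR κ Φ p O a ℓ ≤ WMR κ Φ p O a := by
  have hs := strides_at hat a
  refine ⟨by have := hs.2.2.2.1; unfold sS at this; exact this, by have := hs.2.2.2.2.2.2.1; unfold sS at this; exact this, le_rfl,
    fun ℓ hℓ => ?_⟩
  have h0 := (Mu_succ_le_ℓ₀_at hat a).2
  have hb := (extents_le_at hat a).1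
  unfold WbR WMR
  exact widths_oth_mono hat a (h0.trans (le_max_right _ _)) (max_le (by omega) (by omega))

/-! ## §2 The placement rooms of the root run (`cb = 0`) -/

/-- Counting: `17 r∥ ≤ caR + (NR+1)·e∥ ≤ 23 r∥ ≤ 25 r∥`, and `NR ≤ 12A ≤ nmax A`. [folklore] -/
theorem root_reach (a : Fin 2) : 17 * (cells κ Φ p O).r a ≤ caR κ Φ p O a + (NR κ Φ p O a + 1) * e κ Φ p O a ∧
    caR κ Φ p O a + (NR κ Φ p O a + 1) * e κ Φ p O a ≤ 23 * (cells κ Φ p O).r a ∧ NR κ Φ p O a ≤ 12 * A κ ∧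
    NR κ Φ p O a ≤ Skelφ.Prm.nmax (A κ) := by
  have hr := cells_r_at hat a
  have he := one_le_e_at hat a
  have hu := units_large_at hat a
  have hEr := (e_le_r_at hat a).1
  have h := lt_div_succ_mul (x := 17 * (cells κ Φ p O).r a - caR κ Φ p O a) (y := e κ Φ p O a) (by omega)
  have hle : NR κ Φ p O a * e κ Φ p O a ≤ 17 * (cells κ Φ p O).r a - caR κ Φ p O a := by unfold NR; exact Nat.div_mul_le_self _ _
  have hca : caR κ Φ p O a = 5 * (cells κ Φ p O).r a + 1 + e κ Φ p O a + 2 * R' κ Φ p O := rfl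
  have h12 : 12 * (cells κ Φ p O).r a = 12 * A κ * e κ Φ p O a := by rw [hr]; ring
  have hN : NR κ Φ p O a ≤ 12 * A κ := by
    refine Nat.le_of_mul_le_mul_right ?_ he
    omega
  refine ⟨?_, ?_, hN, ?_⟩
  · unfold NR at h ⊢; omega
  · rw [Nat.add_mul, Nat.one_mul]; omega
  · unfold Skelφ.Prm.nmax; omega

/-- **The placement rooms** of `RootRun2.RootBandOK` with `cb = 0`: `hlo : 5r∥ + 1 + ρ₀R ≤ caR` (equality), `hhi : caR + (NR+1)e∥ ≤ 25 r∥`,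
`htr : ρR ≤ 5 r⊥ − 1`, `hloM`, `hhiM`, `htrM : (qR' + R′ + WMR) + NR·R′ ≤ 3 r⊥`. [folklore] -/
theorem root_rooms (a : Fin 2) : 5 * (cells κ Φ p O).r a + 1 + ρ₀R κ Φ p O a ≤ caR κ Φ p O a ∧
    caR κ Φ p O a + (NR κ Φ p O a + 1) * e κ Φ p O a ≤ 25 * (cells κ Φ p O).r a ∧
    ρR κ Φ p O a + 1 ≤ 5 * (cells κ Φ p O).r (oth a) ∧
    17 * (cells κ Φ p O).r a ≤ caR κ Φ p O a + (NR κ Φ p O a + 1) * e κ Φ p O a ∧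
    caR κ Φ p O a + (NR κ Φ p O a + 1) * e κ Φ p O a ≤ 23 * (cells κ Φ p O).r a ∧
    qR' κ Φ p O a + R' κ Φ p O + WMR κ Φ p O a + NR κ Φ p O a * R' κ Φ p O ≤ 3 * (cells κ Φ p O).r (oth a) := by
  obtain ⟨h17, h23, hN, -⟩ := root_reach hat a
  have hA := hundred_le_A κ
  have hL := five_le_L κ
  -- transverse: the two widths are ≤ r⊥/8, `(NR+1)R′ ≤ (12A+1)R′ ≤ e⊥ ≤ r⊥/A`
  have hb := extents_le_at hat a
  have hk1 : O.D.k ≤ ℓ1 κ Φ p O a := (Mu_succ_le_ℓ₀_at hat a).2.trans (hb.1.trans hb.2.1)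
  have hkE : O.D.k ≤ e κ Φ p O a + R' κ Φ p O := (n₀_le_e_at hat a).2.trans (Nat.le_add_right _ _)
  have hER : e κ Φ p O a + R' κ Φ p O ≤ ℓtop κ Φ p O a := by
    have := units_large_at hat a; unfold ℓtop; nlinarith
  have hw1 : 8 * qR' κ Φ p O a ≤ (cells κ Φ p O).r (oth a) := by
    unfold qR'; fin_cases a
    · simpa [oth] using spread_x_at hat hk1 hb.2.2.1
    · simpa [oth] using spread_y_at hat hk1 hb.2.2.1
  have hw2 : 8 * WMR κ Φ p O a ≤ (cells κ Φ p O).r (oth a) := by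
    unfold WMR; fin_cases a
    · simpa [oth] using spread_x_at hat hkE hER
    · simpa [oth] using spread_y_at hat hkE hER
  have hro := cells_r_at hat (oth a)
  have huo := units_large_at hat (oth a)
  have hRr : (12 * A κ + 2) * R' κ Φ p O ≤ e κ Φ p O (oth a) := by nlinarith [huo.1]
  have hNR : (NR κ Φ p O a + 1) * R' κ Φ p O ≤ (12 * A κ + 2) * R' κ Φ p O := Nat.mul_le_mul_right _ (by omega)
  have heo : e κ Φ p O (oth a) ≤ (cells κ Φ p O).r (oth a) := (e_le_r_at hat (oth a)).1
  have hr100 := (e_le_r_at hat (oth a)).2.2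
  refine ⟨by unfold ρ₀R caR; omega, h23.trans (by omega), ?_, h17, h23, ?_⟩
  · unfold ρR; nlinarith
  · nlinarith

/-! ## §3 Accuracies and counts at the root-run length -/

/-- At the root-run length `NR ≤ nmax A`: `δkit ≤ δr NR`, hence `δI ≤ (δr NR)²`, `η ≤ δr NR / 2`, and the counts at accuracy `δr NR`. [folklore] -/
theorem root_acc (a : Fin 2) (hp0 : 0 < (p : ℝ)) (hp1 : (p : ℝ) < 1) :
    δkit κ Φ ≤ κ.δr (NR κ Φ p O a) ∧ δI κ Φ ≤ κ.δr (NR κ Φ p O a) ^ 2 ∧ η κ Φ ≤ κ.δr (NR κ Φ p O a) / 2 ∧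
    (1 - (q : ℝ) ^ sB Φ O) ^ kP κ Φ p O ≤ κ.δr (NR κ Φ p O a) ∧
    (∀ L', Lcnt κ Φ p O ≤ L' → 1 / (1 - (q : ℝ)) ^ (Φ.Δ * NP κ Φ p O) ≤ κ.δr (NR κ Φ p O a) * (L' : ℝ)) := by
  have hle : δkit κ Φ ≤ κ.δr (NR κ Φ p O a) := (δkit_facts κ Φ).2.2.2.2.1 _ (root_reach hat a).2.2.2
  have hc := counts_at_le hat hp0 hp1 hle
  refine ⟨hle, (δI_facts κ Φ).2.1.trans (pow_le_pow_left₀ (δkit_facts κ Φ).1.le hle 2), ?_, hc.1, hc.2⟩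
  rw [(η_facts κ Φ).2.1]; linarith

/-! ## §4 The depths of the root run against `L′`, `E₀`, `F 1`, `Rt` -/

omit hat in
/-- **The root tube radius**: `Rt + 1 = F 1 − L′`, `Rt = E₀ + L′ + Rex(E₀+1) + 100 rmax`, so `60 rmax ≤ Rt`, `L′ ≤ Rt`, `E₀ ≤ Rt`, and the excess radius at
entrance depth `E₀ + 1` fits: `Rex q (E₀+1) ≤ Rt − L′`. [folklore] -/
theorem Rt_facts : Rt κ Φ p O q + 1 = Frad (Skelφ.Prm.gap (schedIn κ Φ p O q)) (fun _ => 0) (Skelφ.Prm.E₀ (schedIn κ Φ p O q)) 1 -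
      Skelφ.Prm.Lp (schedIn κ Φ p O q) ∧
    Rt κ Φ p O q = Skelφ.Prm.E₀ (schedIn κ Φ p O q) + Skelφ.Prm.Lp (schedIn κ Φ p O q) + Rex κ Φ p O q (Skelφ.Prm.E₀ (schedIn κ Φ p O q) + 1) +
      100 * (cells κ Φ p O).rmax ∧
    60 * (cells κ Φ p O).rmax ≤ Rt κ Φ p O q ∧ Skelφ.Prm.Lp (schedIn κ Φ p O q) ≤ Rt κ Φ p O q ∧ Skelφ.Prm.E₀ (schedIn κ Φ p O q) ≤ Rt κ Φ p O q ∧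
    Rex κ Φ p O q (Skelφ.Prm.E₀ (schedIn κ Φ p O q) + 1) ≤ Rt κ Φ p O q - Skelφ.Prm.Lp (schedIn κ Φ p O q) := by
  have h := (fibre_at (κ := κ) (Φ := Φ) (p := p) (O := O) (q := q) 0 0).2.2.2.2.2
  unfold Rt
  omega

/-- **The kit threshold and the depths fit**: `rs ≤ reachK ≤ L′` (`hr₀L : r₀ ≤ L′`), `L′ ≤ Rt` (`hLR`), `R₀R + 1 ≤ E₀`, `RpR + 1 ≤ E₀`, `R₀R ≤ Rt`, `RpR ≤ Rt`,
`1 ≤ E₀`, `E₀ ≤ F 1`. [folklore] -/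
theorem root_depths (a : Fin 2) : rs Φ O ≤ Skelφ.Prm.Lp (schedIn κ Φ p O q) ∧ R₀R κ Φ p O a + 1 ≤ Skelφ.Prm.E₀ (schedIn κ Φ p O q) ∧
    RpR κ Φ p O a + 1 ≤ Skelφ.Prm.E₀ (schedIn κ Φ p O q) ∧ R₀R κ Φ p O a ≤ Rt κ Φ p O q ∧ RpR κ Φ p O a ≤ Rt κ Φ p O q ∧
    1 ≤ Skelφ.Prm.E₀ (schedIn κ Φ p O q) ∧
    Skelφ.Prm.E₀ (schedIn κ Φ p O q) ≤ Frad (Skelφ.Prm.gap (schedIn κ Φ p O q)) (fun _ => 0) (Skelφ.Prm.E₀ (schedIn κ Φ p O q)) 1 := by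
  have hRt := Rt_facts (κ := κ) (Φ := Φ) (p := p) (O := O) (q := q)
  have hE := E₀_at hat
  have hψ : O.D.R = Skelφ.fatRadius Φ.frame hC := (R_Λ_eq hat).1
  have hmono : Monotone O.D.R := by rw [hψ]; exact Skelφ.fatRadius_mono Φ.frame hC
  -- `rs ≤ reachK ≤ L′`
  have hrk : rs Φ O ≤ reachK Φ O := by unfold reachK; omega
  have hkL : reachK Φ O ≤ Skelφ.Prm.Lp (schedIn κ Φ p O q) := Skelφ.Prm.reachK_le_Lp (schedIn κ Φ p O q)
  -- `ψ(D.k) + off ≤ Kd ≤ rs` (`Kd ≥ ρz = ψ Mu + off`, `D.k ≤ Mu`)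
  have hKd : O.D.R O.D.k + O.off ≤ rs Φ O := by
    have h1 : O.D.R O.D.k ≤ O.D.R (Mu O) := hmono (Mu_facts hat).2.2.2
    have h2 : O.D.R (Mu O) + O.off ≤ Skelφ.Prm.Kd O.D (Mu O) (ρz O) := by
      show ρz O ≤ _; unfold Skelφ.Prm.Kd; exact le_trans (le_max_right _ _) (Nat.le_add_left _ _)
    have h3 := (Skelφ.Prm.Rseed_le_rs O.D (Mu O) G Φ.φ Φ.types (ρz O)).2
    show O.D.R O.D.k + O.off ≤ Skelφ.Prm.rs O.D (Mu O) G Φ.φ Φ.types (ρz O)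
    omega
  -- the first-hop prism radius `ψ(amax (widths a ℓ1)) ≤ ψ topScale ≤ L_A ≤ L′`
  have hb := extents_le_at hat a
  have hS := Smin_Smax_at hat a
  have hk1 : O.D.k ≤ ℓ1 κ Φ p O a := (Mu_succ_le_ℓ₀_at hat a).2.trans (hb.1.trans hb.2.1)
  have h1S : ℓ1 κ Φ p O a ≤ Smax κ Φ p O := hb.2.2.1.trans hS.2.1
  have hamax : Skelφ.amax (Skelφ.StepI.widths O.D.Gb O.D.Fb a (ℓ1 κ Φ p O a)) ≤ topScale κ Φ p O := by
    have hm := Gb_Fb_mono_at hat hk1 h1S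
    have hw := amax_widths_le O.D.Gb O.D.Fb a (ℓ1 κ Φ p O a)
    unfold topScale; omega
  have hψtop : O.D.R (Skelφ.amax (Skelφ.StepI.widths O.D.Gb O.D.Fb a (ℓ1 κ Φ p O a))) ≤ Skelφ.Prm.Lp (schedIn κ Φ p O q) := by
    refine (hmono hamax).trans ?_
    show (schedIn κ Φ p O q).ψtop ≤ _
    have := Skelφ.Prm.hL_face (schedIn κ Φ p O q)
    unfold Skelφ.Prm.LA at this; omega
  have hr5 : 5 * (cells κ Φ p O).r a + 1 ≤ 45 * (cells κ Φ p O).rmax := by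
    have := (r_le_rmax_at hat a).1; have := (r_le_rmax_at hat a).2; omega
  have hE0 : Skelφ.Prm.Lp (schedIn κ Φ p O q) + 45 * (cells κ Φ p O).rmax ≤ Skelφ.Prm.E₀ (schedIn κ Φ p O q) := by
    show _ ≤ Skelφ.Prm.Lp (schedIn κ Φ p O q) + 45 * (schedIn κ Φ p O q).rmax + (schedIn κ Φ p O q).ψM
    exact Nat.le_add_right _ _
  have hR₀ : R₀R κ Φ p O a + 1 ≤ Skelφ.Prm.E₀ (schedIn κ Φ p O q) := by
    have : R₀R κ Φ p O a = 5 * (cells κ Φ p O).r a + (O.D.R O.D.k + O.off) := by unfold R₀R; omega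
    rw [this]
    calc 5 * (cells κ Φ p O).r a + (O.D.R O.D.k + O.off) + 1 ≤ 45 * (cells κ Φ p O).rmax + Skelφ.Prm.Lp (schedIn κ Φ p O q) := by
          have := hKd.trans (hrk.trans hkL); omega
      _ ≤ _ := by rw [Nat.add_comm]; exact hE0
  have hRp : RpR κ Φ p O a + 1 ≤ Skelφ.Prm.E₀ (schedIn κ Φ p O q) := by
    unfold RpR
    calc 5 * (cells κ Φ p O).r a + O.D.R (Skelφ.amax (Skelφ.StepI.widths O.D.Gb O.D.Fb a (ℓ1 κ Φ p O a))) + 1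
        ≤ 45 * (cells κ Φ p O).rmax + Skelφ.Prm.Lp (schedIn κ Φ p O q) := by omega
      _ ≤ _ := by rw [Nat.add_comm]; exact hE0
  have hERt : Skelφ.Prm.E₀ (schedIn κ Φ p O q) ≤ Rt κ Φ p O q := hRt.2.2.2.2.1
  refine ⟨hrk.trans hkL, hR₀, hRp, ?_, ?_, le_trans (by omega) hR₀, Skel.E₀_le_Frad _ _ _ 1⟩
  · exact le_trans (Nat.le_succ _) (hR₀.trans hERt)
  · exact le_trans (Nat.le_succ _) (hRp.trans hERt)

/-! ## §5 p2-g8's standard root run (`RootRun2.rootBandOKR_std`, `caStd = caR`, `nStd`): the seven facts, the first hop, uniform depths -/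

/-- **The first hop**: `ℓ1∥ ∈ Sx` (axis 0) / `∈ Sy` (axis 1), `ℓ1 ≤ caR`, `ℓ1 ≤ 5 r∥`, `caR − ℓ1 + D.k ≤ 5 r∥` (the seed's footprint stays in `Q 0`),
`D.k ≤ Mu`, `D.k ≤ 5 r⊥`. [folklore] -/
theorem first_hop_at (a : Fin 2) : ℓ1 κ Φ p O 0 ∈ Sx κ Φ p O ∧ ℓ1 κ Φ p O 1 ∈ Sy κ Φ p O ∧ ℓ1 κ Φ p O a ≤ caR κ Φ p O a ∧
    ℓ1 κ Φ p O a ≤ 5 * (cells κ Φ p O).r a ∧ caR κ Φ p O a - ℓ1 κ Φ p O a + O.D.k ≤ 5 * (cells κ Φ p O).r a ∧ O.D.k ≤ Mu O ∧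
    O.D.k ≤ 5 * (cells κ Φ p O).r (oth a) := by
  have hm := mem_lists_at (κ := κ) (Φ := Φ) (p := p) (O := O)
  have hk := (Mu_facts hat).2.2.2
  have hu := units_large_at hat a
  have hr := (e_le_r_at hat a).1
  have hro := (e_le_r_at hat (oth a)).1
  have huo := units_large_at hat (oth a)
  have hA := hundred_le_A κ
  have hℓ1 : ℓ1 κ Φ p O a = Mu O + e κ Φ p O a + 2 * R' κ Φ p O + 1 := rfl
  have hca : caR κ Φ p O a = 5 * (cells κ Φ p O).r a + 1 + e κ Φ p O a + 2 * R' κ Φ p O := rfl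
  have hr100 := (e_le_r_at hat a).2.2
  refine ⟨hm.2.2.2.1, hm.2.2.2.2, by omega, by omega, by omega, hk, by omega⟩

/-- **Uniform first-hop depths**: `5 r a + (ψ(D.k) + off) ≤ R₀U`, `5 r a + ψ(amax (widths a ℓ1∥)) ≤ RpU`, `R₀U + 1 ≤ E₀`, `RpU + 1 ≤ E₀`, `R₀U ≤ Rt`, `RpU ≤ Rt`.
[folklore] -/
theorem first_hop_depths_at (a : Fin 2) : 5 * (cells κ Φ p O).r a + (O.D.R O.D.k + O.off) ≤ R₀U κ Φ p O ∧
    5 * (cells κ Φ p O).r a + O.D.R (Skelφ.amax (Skelφ.StepI.widths O.D.Gb O.D.Fb a (ℓ1 κ Φ p O a))) ≤ RpU κ Φ p O ∧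
    R₀U κ Φ p O + 1 ≤ Skelφ.Prm.E₀ (schedIn κ Φ p O q) ∧ RpU κ Φ p O + 1 ≤ Skelφ.Prm.E₀ (schedIn κ Φ p O q) ∧
    R₀U κ Φ p O ≤ Rt κ Φ p O q ∧ RpU κ Φ p O ≤ Rt κ Φ p O q := by
  have hrm := r_le_rmax_at hat a
  have hE₀ : Skelφ.Prm.E₀ (schedIn κ Φ p O q) = Skelφ.Prm.Lp (schedIn κ Φ p O q) + 45 * (cells κ Φ p O).rmax + ψMz O := rfl
  have hψ : O.D.R = Skelφ.fatRadius Φ.frame hC := (R_Λ_eq hat).1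
  have hmono : Monotone O.D.R := by rw [hψ]; exact Skelφ.fatRadius_mono Φ.frame hC
  have hb := extents_le_at hat a
  have hS := Smin_Smax_at hat a
  have hk1 : O.D.k ≤ ℓ1 κ Φ p O a := (Mu_succ_le_ℓ₀_at hat a).2.trans (hb.1.trans hb.2.1)
  have hamax := hmono (amax_widths_le_topScale hat a hk1 (hb.2.2.1.trans hS.2.1))
  have hE := E₀_at hat
  have hRt := Rt_facts (κ := κ) (Φ := Φ) (p := p) (O := O) (q := q)
  -- `ψ(D.k) + off ≤ ψMz ≤ …` and `ψ(topScale) = ψtop ≤ L_A ≤ L′`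
  have hz := (ψMz_ge (O := O)).2.2
  have hkMu : O.D.R O.D.k ≤ O.D.R (Mu O) := hmono (Mu_facts hat).2.2.2
  have hLA : O.D.R (topScale κ Φ p O) ≤ Skelφ.Prm.Lp (schedIn κ Φ p O q) := by
    show (schedIn κ Φ p O q).ψtop ≤ _
    have := Skelφ.Prm.hL_face (schedIn κ Φ p O q)
    unfold Skelφ.Prm.LA at this; omega
  have hR₀ : R₀U κ Φ p O + 1 ≤ Skelφ.Prm.E₀ (schedIn κ Φ p O q) := by unfold R₀U; omega
  have hRp : RpU κ Φ p O + 1 ≤ Skelφ.Prm.E₀ (schedIn κ Φ p O q) := by unfold RpU; omega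
  refine ⟨by unfold R₀U; omega, by unfold RpU; omega, hR₀, hRp, ?_, ?_⟩
  · exact le_trans (Nat.le_succ _) (hR₀.trans hRt.2.2.2.2.1)
  · exact le_trans (Nat.le_succ _) (hRp.trans hRt.2.2.2.2.1)

/-- **Accuracies at ANY run length `n ≤ nmax A`** (p2-g8's `N := nStd − 1 ≤ 12A`, hp-8's `nA`): `δkit ≤ δr n`, `δI ≤ (δr n)²`, `η ≤ δr n/2`,
`0 < δr n ≤ 1`, and the counts at accuracy `δr n`. [folklore] -/
theorem acc_at_length (n : ℕ) (hn : n ≤ Skelφ.Prm.nmax (A κ)) (hp0 : 0 < (p : ℝ)) (hp1 : (p : ℝ) < 1) :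
    δkit κ Φ ≤ κ.δr n ∧ δI κ Φ ≤ κ.δr n ^ 2 ∧ η κ Φ ≤ κ.δr n / 2 ∧ 0 < κ.δr n ∧ κ.δr n ≤ 1 ∧
    (1 - (q : ℝ) ^ sB Φ O) ^ kP κ Φ p O ≤ κ.δr n ∧
    (∀ L', Lcnt κ Φ p O ≤ L' → 1 / (1 - (q : ℝ)) ^ (Φ.Δ * NP κ Φ p O) ≤ κ.δr n * (L' : ℝ)) := by
  have hle : δkit κ Φ ≤ κ.δr n := (δkit_facts κ Φ).2.2.2.2.1 n hn
  have hc := counts_at_le hat hp0 hp1 hle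
  refine ⟨hle, (δI_facts κ Φ).2.1.trans (pow_le_pow_left₀ (δkit_facts κ Φ).1.le hle 2), ?_, (κ.hδr n).1, (κ.hδr n).2, hc.1, hc.2⟩
  rw [(η_facts κ Φ).2.1]; linarith

omit hat in
/-- The window levels of every kit call: `j₀ := T₀ = tanOff M M` (`hj₀`), `j₁ := Rlev`, `#Icc T₀ Rlev = Lcnt + 1 ≥ Lcnt` (`hcount` via `acc_at_length`),
`j₁ ≤ Rlev`, `Rlev + 1 ≤ R′` (`hRl`). [folklore] -/
theorem levels_at : SkelI.tanOff (M O) (M O) = T₀ O ∧ (Finset.Icc (T₀ O) (Rlev κ Φ p O)).card = Lcnt κ Φ p O + 1 ∧ Lcnt κ Φ p O ≤ Lcnt κ Φ p O + 1 ∧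
    Rlev κ Φ p O + 1 = R' κ Φ p O := by
  refine ⟨rfl, ?_, Nat.le_succ _, rfl⟩
  rw [Nat.card_Icc]; unfold Rlev; omega


end AtQ

/-- `12·A + 2 ≤ nmax A` (so every root-run length of p2-g8's bracket `N + 1 = nStd ≤ 12A` is covered). [folklore] -/
theorem twelve_A_le_nmax (κ : Consts) : 12 * A κ + 2 ≤ Skelφ.Prm.nmax (A κ) := by unfold Skelφ.Prm.nmax; omega

end Sgn₂

end PlanarSkeletonSign

end Summit.CriticalPhenomena.PercolationContinuityZ3.Theorems.Transplant

end
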